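import Summits.Ventures.CertifiedManyBodySolver.Downfold.S2SeamEmery
import Literature.MathematicalPhysics.QuantumLattice.HubbardCoupledLadderArray
import HarnessLib

/-!
# The declared oxygen reference level of the 3BE seam is immaterial: shifting `(ε_d, ε_p)` together by
# `c` shifts every certified three-band energy word of the decorated `CuO₂` model by exactly `c · ρ`

Venture CertifiedManyBodySolver, cell `pub/hubbard-downfold` (stage S1 = ROUTER), seat hubbard-downfold-mod-4;
namespace `Summit.Ventures.CertifiedManyBodySolver.Downfold`. Sequel of `Downfold.S2SeamEmery`, whose adapter
`emeryLineCoords εp p = (t_pd, t_pp, εp + Δ_pd, εp, U_dd, U_pp)` reads a three-band box at a DECLARED oxygen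
reference level `εp` — a router box prints only `Δ_pd = ε_d − ε_p`. This file PROVES the claim made there in
prose: for the decorated model of record (`Literature/…/EmeryThreeBandByDecoration`, hubbard-box-p1) the
variational energy density at cell filling `ρ` depends on `(ε_d, ε_p)` only through `Δ_pd`, up to the trivial
affine shift `c · ρ`; so an S2 producer may fix `εp = 0` without loss, and floors transform covariantly.

* §1 coset bookkeeping on a general rectangular superlattice (`Cell q`, `cellPos`, `cellRep`, `InCoset` of the
  prequels): `inCoset_comm`; `sum_ite_inCoset_sub_cellPos` (exactly ONE point of the fundamental cell lies in a
  given coset); `cellEnergy_sublatticeOnSiteViews_one_zero` — the cell energy of the unit on-site-ENERGY views on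
  coset `c` is `|C|⁻¹ ·` the density at the cell representative of `c`.
* §2 the decorated `CuO₂` cell: the representatives of `cuSite, oxSite, oySite, dummySite` and the enumeration of
  the `2 × 2` cell; `cellFilling_lieb` (`ρ̄ = ¼(ρ_Cu + ρ_Ox + ρ_Oy + ρ_dummy)`); hence on the class `emeryStates ρ`
  (dummy empty, cell filling `ρ`) the three site-energy directions `8, 9, 10` of `emeryDirections` have cell
  energies summing to `ρ` (`sum_cellEnergy_levelDirections_eq`).
* §3 `levelDir = e₈ + e₉ + e₁₀ ∈ ℝ¹⁴`; `cellEnergy_emeryViews_add_levelShift` (`e_{θ + c·levelDir}(ω) = e_θ(ω) + cρ`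
  on the class) and **`emeryEnergyDensity_add_levelShift`**: `e(θ + c·levelDir, ρ) = e(θ, ρ) + c·ρ` (non-empty
  class; both sides are variational infima, compared through `le_infCellEnergyOn` / `infCellEnergyOn_le_cellEnergy`).
* §4 the seam: `emeryLine_emeryLineCoords_add` (raising the reference level by `c` IS the shift `c·levelDir` along
  box-p1's physical line) and **`emeryEnergyDensity_emeryLineCoords_refLevel`**:
  `e(line(coords (εp + c) p), ρ) = e(line(coords εp p), ρ) + c·ρ`; floors: `le_emeryEnergyDensity_refLevel_iff`.

Everything here is PROVED; no definition beyond `levelDir` and the four named cell points; no number about a material.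
-/

noncomputable section

namespace Summit.Ventures.CertifiedManyBodySolver.Downfold

open Matrix Finset Literature.Probability.LatticeModels
open Literature.MathematicalPhysics.QuantumLattice Literature.Computation.Certificates
open scoped BigOperators

/-! ## §1 One cell point per coset; the cell energy of on-site-energy views -/

section Coset

variable {d : ℕ}

/-- Coset membership is symmetric (congruence modulo the periods). [cite: ArakiMoriya2003, §4.1] -/
theorem inCoset_comm (q : Fin d → ℕ) (c x : Site d) : InCoset q c x ↔ InCoset q x c := by
  refine forall_congr' fun i => ?_
  rw [← Int.dvd_iff_emod_eq_zero, ← Int.dvd_iff_emod_eq_zero]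
  exact dvd_sub_comm

/-- **Exactly one point of the fundamental cell lies in the coset of `c`** — the cell representative:
`Σ_n [0 ∈ coset(c − pos n)] f n = f (cellRep c)`. [cite: ArakiMoriya2003, §4.1] -/
theorem sum_ite_inCoset_sub_cellPos (q : Fin d → ℕ) (c : Site d) (f : Cell q → ℝ) :
    ∑ n : Cell q, (if InCoset q (c - cellPos n) 0 then f n else 0) = f (cellRep q c) := by
  have h : ∀ n : Cell q, (InCoset q (c - cellPos n) 0 ↔ n = cellRep q c) := fun n => by
    rw [inCoset_sub_zero_iff, inCoset_comm, inCoset_cellPos_iff]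
  simp_rw [h]
  rw [Finset.sum_ite_eq' Finset.univ (cellRep q c) f, if_pos (Finset.mem_univ _)]

/-- **Cell energy of the unit on-site-energy views on coset `c`** (`ε = 1`, `U = 0`): `|C|⁻¹ ·` the density of the
state seen from the cell representative of `c`. [cite: BratteliKishimotoRobinson1978, §3 (mean energy functional)] -/
theorem cellEnergy_sublatticeOnSiteViews_one_zero (q : Fin d → ℕ) (c : Site d) (R : ℝ) (ω : InfVolFermionState d) :
    ω.cellEnergy (sublatticeOnSiteViews q c 1 0) R =
      (Fintype.card (Cell q) : ℝ)⁻¹ * (ω.shift (cellPos (cellRep q c))).density := by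
  rw [InfVolFermionState.cellEnergy]
  congr 1
  have h : ∀ n : Cell q, (ω.shift (cellPos n)).meanEnergy (sublatticeOnSiteViews q c 1 0 n) R =
      if InCoset q (c - cellPos n) 0 then (ω.shift (cellPos n)).density else 0 := fun n => by
    rw [sublatticeOnSiteViews, InfVolFermionState.meanEnergy_sublatticeOnSite]
    by_cases hc : InCoset q (c - cellPos n) 0
    · rw [if_pos hc, if_pos hc, one_mul, zero_mul, add_zero]
    · rw [if_neg hc, if_neg hc]
  simp_rw [h]
  exact sum_ite_inCoset_sub_cellPos q c (fun n => (ω.shift (cellPos n)).density)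

/-- The cell representative of a cell point is itself. [cite: ArakiMoriya2003, §4.1] -/
theorem cellRep_cellPos (q : Fin d → ℕ) (n : Cell q) : cellRep q (cellPos n) = n :=
  ((inCoset_cellPos_iff q n (cellPos n)).1 (inCoset_self q (cellPos n))).symm

end Coset

/-! ## §2 The `2 × 2` decorated cell: representatives, enumeration, filling -/

/-- The cell point of the copper site `(0,0)`. [cite: PavariniEtAl2001, eq. (1)] -/
def cuCell : Cell liebPeriods := fun _ => 0
/-- The cell point of the `O_x` site `(1,0)`. [cite: PavariniEtAl2001, eq. (1)] -/
def oxCell : Cell liebPeriods := fun i => if i = 0 then 1 else 0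
/-- The cell point of the `O_y` site `(0,1)`. [cite: PavariniEtAl2001, eq. (1)] -/
def oyCell : Cell liebPeriods := fun i => if i = 0 then 0 else 1
/-- The cell point of the dummy site `(1,1)`. [cite: PavariniEtAl2001, eq. (1)] -/
def dummyCell : Cell liebPeriods := fun _ => 1

/-- `pos cuCell = cuSite`. [cite: PavariniEtAl2001, eq. (1)] -/
theorem cellPos_cuCell : cellPos cuCell = cuSite := by
  ext i; fin_cases i <;> simp [cellPos, cuCell, cuSite]

/-- `pos oxCell = oxSite`. [cite: PavariniEtAl2001, eq. (1)] -/
theorem cellPos_oxCell : cellPos oxCell = oxSite := by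
  ext i; fin_cases i <;> simp [cellPos, oxCell, oxSite, unitVec, liebPeriods]

/-- `pos oyCell = oySite`. [cite: PavariniEtAl2001, eq. (1)] -/
theorem cellPos_oyCell : cellPos oyCell = oySite := by
  ext i; fin_cases i <;> simp [cellPos, oyCell, oySite, unitVec, liebPeriods]

/-- `pos dummyCell = dummySite`. [cite: PavariniEtAl2001, eq. (1)] -/
theorem cellPos_dummyCell : cellPos dummyCell = dummySite := by
  ext i; fin_cases i <;> simp [cellPos, dummyCell, dummySite, unitVec, liebPeriods]

/-- `cellRep cuSite = cuCell`. [cite: ArakiMoriya2003, §4.1] -/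
theorem cellRep_cuSite : cellRep liebPeriods cuSite = cuCell := by
  rw [← cellPos_cuCell, cellRep_cellPos]

/-- `cellRep oxSite = oxCell`. [cite: ArakiMoriya2003, §4.1] -/
theorem cellRep_oxSite : cellRep liebPeriods oxSite = oxCell := by
  rw [← cellPos_oxCell, cellRep_cellPos]

/-- `cellRep oySite = oyCell`. [cite: ArakiMoriya2003, §4.1] -/
theorem cellRep_oySite : cellRep liebPeriods oySite = oyCell := by
  rw [← cellPos_oyCell, cellRep_cellPos]

/-- The decorated cell has four points. [cite: ArakiMoriya2003, §4.1] -/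
theorem card_cell_lieb : Fintype.card (Cell liebPeriods) = 4 := by
  decide

/-- **Enumeration of the `2 × 2` cell**: `{Cu, O_x, O_y, dummy}`. [cite: ArakiMoriya2003, §4.1] -/
theorem univ_cell_lieb : (Finset.univ : Finset (Cell liebPeriods)) = {cuCell, oxCell, oyCell, dummyCell} := by
  symm
  apply Finset.eq_univ_of_card
  rw [Finset.card_insert_of_notMem (by decide), Finset.card_insert_of_notMem (by decide),
    Finset.card_insert_of_notMem (by decide), Finset.card_singleton, card_cell_lieb]

/-- **The cell filling of the decorated lattice**: `ρ̄(ω) = ¼ (ρ(ω∘τ_Cu) + ρ(ω∘τ_{O_x}) + ρ(ω∘τ_{O_y}) + ρ(ω∘τ_dummy))`.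
[cite: ArakiMoriya2003, §4.1] -/
theorem cellFilling_lieb (ω : InfVolFermionState 2) :
    ω.cellFilling liebPeriods = 4⁻¹ * ((ω.shift cuSite).density + (ω.shift oxSite).density +
      (ω.shift oySite).density + (ω.shift dummySite).density) := by
  rw [InfVolFermionState.cellFilling, card_cell_lieb, univ_cell_lieb,
    Finset.sum_insert (by decide), Finset.sum_insert (by decide), Finset.sum_insert (by decide),
    Finset.sum_singleton, cellPos_cuCell, cellPos_oxCell, cellPos_oyCell, cellPos_dummyCell]
  push_cast
  ring

/-- The Cu site-energy direction (`a = 8`) has cell energy `¼ ρ(ω∘τ_Cu)`. [cite: BratteliKishimotoRobinson1978, §3 (mean energy functional)] -/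
theorem cellEnergy_emeryDirections_8 (ω : InfVolFermionState 2) :
    ω.cellEnergy (emeryDirections 8) 1 = 4⁻¹ * (ω.shift cuSite).density := by
  have h8 : emeryDirections 8 = sublatticeOnSiteViews liebPeriods cuSite 1 0 := rfl
  rw [h8, cellEnergy_sublatticeOnSiteViews_one_zero, card_cell_lieb, cellRep_cuSite, cellPos_cuCell]
  norm_num

/-- The `O_x` site-energy direction (`a = 9`) has cell energy `¼ ρ(ω∘τ_{O_x})`. [cite: BratteliKishimotoRobinson1978, §3 (mean energy functional)] -/
theorem cellEnergy_emeryDirections_9 (ω : InfVolFermionState 2) :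
    ω.cellEnergy (emeryDirections 9) 1 = 4⁻¹ * (ω.shift oxSite).density := by
  have h9 : emeryDirections 9 = sublatticeOnSiteViews liebPeriods oxSite 1 0 := rfl
  rw [h9, cellEnergy_sublatticeOnSiteViews_one_zero, card_cell_lieb, cellRep_oxSite, cellPos_oxCell]
  norm_num

/-- The `O_y` site-energy direction (`a = 10`) has cell energy `¼ ρ(ω∘τ_{O_y})`. [cite: BratteliKishimotoRobinson1978, §3 (mean energy functional)] -/
theorem cellEnergy_emeryDirections_10 (ω : InfVolFermionState 2) :
    ω.cellEnergy (emeryDirections 10) 1 = 4⁻¹ * (ω.shift oySite).density := by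
  have h10 : emeryDirections 10 = sublatticeOnSiteViews liebPeriods oySite 1 0 := rfl
  rw [h10, cellEnergy_sublatticeOnSiteViews_one_zero, card_cell_lieb, cellRep_oySite, cellPos_oyCell]
  norm_num

/-- **On the variational class (dummy empty, cell filling `ρ`) the three site-energy directions sum to `ρ`.**
[cite: ArakiMoriya2003, §4.1 Def. 4.5] -/
theorem sum_cellEnergy_levelDirections_eq {ρ : ℝ} {ω : InfVolFermionState 2} (hω : ω ∈ emeryStates ρ) :
    ω.cellEnergy (emeryDirections 8) 1 + ω.cellEnergy (emeryDirections 9) 1 + ω.cellEnergy (emeryDirections 10) 1 = ρ := by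
  obtain ⟨-, hdum, hfill⟩ := hω
  rw [cellFilling_lieb, hdum] at hfill
  rw [cellEnergy_emeryDirections_8, cellEnergy_emeryDirections_9, cellEnergy_emeryDirections_10]
  linarith

/-! ## §3 The level shift in coupling space and the energy density -/

/-- **The level-shift direction** `levelDir = e₈ + e₉ + e₁₀ ∈ ℝ¹⁴` (Cu, O_x, O_y site energies raised together).
[cite: PavariniEtAl2001, eq. (1)] -/
def levelDir : Fin 14 → ℝ := ![0, 0, 0, 0, 0, 0, 0, 0, 1, 1, 1, 0, 0, 0]

/-- Pairing the level shift with the conjugate densities: `Σ_a (c · levelDir a) e_{D_a} = c (e₈ + e₉ + e₁₀)`. [folklore] -/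
theorem sum_levelDir_mul (c : ℝ) (e : Fin 14 → ℝ) :
    ∑ a, (c * levelDir a) * e a = c * (e 8 + e 9 + e 10) := by
  simp [Fin.sum_univ_succ, levelDir]
  ring

/-- **Cell energy under a common level shift**: `e_{θ + c·levelDir}(ω) = e_θ(ω) + c·ρ` for every state of the class.
[cite: KomaTasaki1994, §1] -/
theorem cellEnergy_emeryViews_add_levelShift {ρ : ℝ} {ω : InfVolFermionState 2} (hω : ω ∈ emeryStates ρ)
    (θ : Fin 14 → ℝ) (c : ℝ) :
    ω.cellEnergy (emeryViews (θ + c • levelDir)) 1 = ω.cellEnergy (emeryViews θ) 1 + c * ρ := by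
  rw [emeryViews, emeryViews, ω.cellEnergy_viewFamily_eq_add_sum_sub_mul _ emeryDirections (θ + c • levelDir) θ 1]
  congr 1
  have h : ∀ a, ((θ + c • levelDir) a - θ a) * ω.cellEnergy (emeryDirections a) 1 =
      (c * levelDir a) * ω.cellEnergy (emeryDirections a) 1 := fun a => by
    simp only [Pi.add_apply, Pi.smul_apply, smul_eq_mul]; ring
  simp_rw [h]
  rw [sum_levelDir_mul, sum_cellEnergy_levelDirections_eq hω]

/-- **THE REFERENCE LEVEL IS IMMATERIAL (coupling-space form).** On a non-empty class, raising the three site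
energies together by `c` shifts the variational energy density by exactly `c·ρ`:
`e(θ + c·levelDir, ρ) = e(θ, ρ) + c·ρ`. [cite: BratteliKishimotoRobinson1978, Thm. 2 (condition 2)] -/
theorem emeryEnergyDensity_add_levelShift {ρ : ℝ} (hne : (emeryStates ρ).Nonempty) (θ : Fin 14 → ℝ) (c : ℝ) :
    emeryEnergyDensity (θ + c • levelDir) ρ = emeryEnergyDensity θ ρ + c * ρ := by
  have key : ∀ (θ : Fin 14 → ℝ) (c : ℝ),
      emeryEnergyDensity θ ρ + c * ρ ≤ emeryEnergyDensity (θ + c • levelDir) ρ := fun θ c => by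
    rw [emeryEnergyDensity, emeryEnergyDensity]
    refine le_infCellEnergyOn _ 1 hne fun ω hω => ?_
    rw [cellEnergy_emeryViews_add_levelShift hω]
    have hle := infCellEnergyOn_le_cellEnergy (emeryViews θ) 1 hω
    linarith
  refine le_antisymm ?_ (key θ c)
  have h := key (θ + c • levelDir) (-c)
  have hθ : θ + c • levelDir + (-c) • levelDir = θ := by
    ext a; simp only [Pi.add_apply, Pi.smul_apply, smul_eq_mul]; ring
  rw [hθ] at h
  linarith

/-! ## §4 The seam: the declared reference level `εp` of `emeryLineCoords` -/

/-- **Raising the reference level by `c` is the shift `c·levelDir` along box-p1's physical line.**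
[cite: PavariniEtAl2001, eq. (1)] -/
theorem emeryLine_emeryLineCoords_add (s : Fin 4 → ℝ) (εp c : ℝ) (p : EmeryCoord → ℝ) :
    emeryLine s (emeryLineCoords (εp + c) p) = emeryLine s (emeryLineCoords εp p) + c • levelDir := by
  ext a
  fin_cases a <;> simp [emeryLine, emeryLineCoords, levelDir]
  ring

/-- **THE DECLARED REFERENCE LEVEL OF THE 3BE SEAM IS IMMATERIAL**: reading the same three-band box at reference
level `εp + c` instead of `εp` shifts every certified energy density by exactly `c·ρ` (non-empty class):
`e(line(coords (εp + c) p), ρ) = e(line(coords εp p), ρ) + c·ρ`. [cite: BratteliKishimotoRobinson1978, Thm. 2 (condition 2)] -/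
theorem emeryEnergyDensity_emeryLineCoords_refLevel {ρ : ℝ} (hne : (emeryStates ρ).Nonempty) (s : Fin 4 → ℝ)
    (εp c : ℝ) (p : EmeryCoord → ℝ) :
    emeryEnergyDensity (emeryLine s (emeryLineCoords (εp + c) p)) ρ =
      emeryEnergyDensity (emeryLine s (emeryLineCoords εp p)) ρ + c * ρ := by
  rw [emeryLine_emeryLineCoords_add, emeryEnergyDensity_add_levelShift hne]

/-- **Floors transform covariantly with the reference level**: `m + c·ρ ≤ e` at level `εp + c` iff `m ≤ e` at
level `εp`. [cite: BratteliKishimotoRobinson1978, Thm. 2 (condition 2)] -/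
theorem le_emeryEnergyDensity_refLevel_iff {ρ : ℝ} (hne : (emeryStates ρ).Nonempty) (s : Fin 4 → ℝ)
    (εp c : ℝ) (p : EmeryCoord → ℝ) (m : ℝ) :
    m + c * ρ ≤ emeryEnergyDensity (emeryLine s (emeryLineCoords (εp + c) p)) ρ ↔
      m ≤ emeryEnergyDensity (emeryLine s (emeryLineCoords εp p)) ρ := by
  rw [emeryEnergyDensity_emeryLineCoords_refLevel hne, add_le_add_iff_right]

end Summit.Ventures.CertifiedManyBodySolver.Downfold

end
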